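import Literature.AlgebraicGeometry.Modules.PullbackStalk
import Literature.NumberTheory.DiophantineGeometry.AVIsogenyFlat
import HarnessLib

/-!
# Pull-back of `𝒪`-modules along an isogeny of abelian varieties is exact

An isogeny `g : A → B` of abelian varieties over a field is flat (Görtz–Wedhorn II, Prop. 27.54;
the tree's `AbelianVariety.IsIsogeny.flat_toSchemeHom_holds`), so by «flat pull-back is exact»
(The Stacks Project, Tag 02N2; the tree's `Modules/PullbackStalk`:
`preservesMonomorphisms_pullback_of_flat`, `preservesFiniteLimits_pullback_of_flat`) the pull-back
functor `g^* = Scheme.Modules.pullback g : Mod(𝒪_B) ⥤ Mod(𝒪_A)` preserves monomorphisms, finite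
limits, exactness and short exact sequences — on ALL `𝒪_B`-modules.

* `AbelianVariety.IsIsogeny.preservesMonomorphisms_pullback` — the form consumed by the cell
  `pub-hodge-ring2` (crux stmt-HodgeConjecture-26512, route K: hypothesis
  `(Scheme.Modules.pullback g).PreservesMonomorphisms` of the `Ext`-adjunction along an isogeny).
* `AbelianVariety.IsIsogeny.preservesFiniteLimits_pullback`, `….preservesHomology_pullback`,
  `….exact_map_pullback`, `….shortExact_map_pullback`.

Everything is proved; no named facts.

## References

* U. Görtz, T. Wedhorn, *Algebraic Geometry II* (2023), Prop. 27.54 (isogenies are flat). [GortzWedhorn2023]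
* The Stacks Project, Tag 02N2 (flat pull-back is exact). [StacksProject]
-/

noncomputable section

open CategoryTheory CategoryTheory.Limits AlgebraicGeometry

universe u

namespace Literature.AlgebraicGeometry.Motives

namespace AbelianVariety

variable {K : Type u} [Field K] {A B : AbelianVariety K}

/-- **Pull-back along an isogeny preserves monomorphisms of `𝒪`-modules** (all modules): an
isogeny is flat (Görtz–Wedhorn II, Prop. 27.54) and flat pull-back is exact (Stacks, Tag 02N2).
[cite: GortzWedhorn2023, Prop. 27.54] [cite: StacksProject, Tag 02N2] -/
theorem IsIsogeny.preservesMonomorphisms_pullback {g : A ⟶ B} (hg : IsIsogeny g) :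
    (Scheme.Modules.pullback (Hom.toSchemeHom g)).PreservesMonomorphisms := by
  haveI : Flat (Hom.toSchemeHom g) := IsIsogeny.flat_toSchemeHom_holds hg
  exact Literature.AlgebraicGeometry.Modules.preservesMonomorphisms_pullback_of_flat _

/-- **Pull-back along an isogeny is exact**: it preserves finite limits (and, being a left
adjoint, all colimits). [cite: GortzWedhorn2023, Prop. 27.54] [cite: StacksProject, Tag 02N2] -/
theorem IsIsogeny.preservesFiniteLimits_pullback {g : A ⟶ B} (hg : IsIsogeny g) :
    PreservesFiniteLimits (Scheme.Modules.pullback (Hom.toSchemeHom g)) := by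
  haveI : Flat (Hom.toSchemeHom g) := IsIsogeny.flat_toSchemeHom_holds hg
  exact Literature.AlgebraicGeometry.Modules.preservesFiniteLimits_pullback_of_flat _

/-- Pull-back along an isogeny preserves homology. [cite: GortzWedhorn2023, Prop. 27.54]
[cite: StacksProject, Tag 02N2] -/
theorem IsIsogeny.preservesHomology_pullback {g : A ⟶ B} (hg : IsIsogeny g) :
    (Scheme.Modules.pullback (Hom.toSchemeHom g)).PreservesHomology := by
  haveI : Flat (Hom.toSchemeHom g) := IsIsogeny.flat_toSchemeHom_holds hg
  exact Literature.AlgebraicGeometry.Modules.preservesHomology_pullback_of_flat _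

/-- Pull-back along an isogeny preserves exactness of short complexes of `𝒪`-modules.
[cite: GortzWedhorn2023, Prop. 27.54] [cite: StacksProject, Tag 02N2] -/
theorem IsIsogeny.exact_map_pullback {g : A ⟶ B} (hg : IsIsogeny g)
    (S : ShortComplex B.X.left.Modules) (hS : S.Exact) :
    (S.map (Scheme.Modules.pullback (Hom.toSchemeHom g))).Exact := by
  haveI : Flat (Hom.toSchemeHom g) := IsIsogeny.flat_toSchemeHom_holds hg
  exact Literature.AlgebraicGeometry.Modules.exact_map_pullback_of_flat _ hS

/-- Pull-back along an isogeny preserves short exact sequences of `𝒪`-modules.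
[cite: GortzWedhorn2023, Prop. 27.54] [cite: StacksProject, Tag 02N2] -/
theorem IsIsogeny.shortExact_map_pullback {g : A ⟶ B} (hg : IsIsogeny g)
    (S : ShortComplex B.X.left.Modules) (hS : S.ShortExact) :
    (S.map (Scheme.Modules.pullback (Hom.toSchemeHom g))).ShortExact := by
  haveI : Flat (Hom.toSchemeHom g) := IsIsogeny.flat_toSchemeHom_holds hg
  exact Literature.AlgebraicGeometry.Modules.shortExact_map_pullback_of_flat' _ hS

end AbelianVariety

end Literature.AlgebraicGeometry.Motives

end
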